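import Summits.Ventures.HodgeRepro2.T5SU11KFiniteMajorant
import Summits.Ventures.HodgeRepro2.T5BergmanCoeffCartan
import Summits.Ventures.HodgeRepro2.T5BergmanKTypes

/-!
# The `K`-finite coefficients of the discrete series are orthogonal to every spherical function:
`∫_G ⟨π_k(g) zᵐ, zⁿ⟩_k φ_λ(g) dν = 0`

A `K`-finite coefficient of the weight-`k` representation transforms under left rotation by the
non-trivial character `u ↦ u^{-(k+2n)}` (`T5BergmanCoeffCartan.matrixCoeff_rot_mul_monomial`), while the
Haar measure `ν` and the spherical function `φ_λ` are left-`K`-invariant; hence the integral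
`I = ∫_G c_{mn} φ_λ dν` satisfies `I = u^{-(k+2n)} I` for every `u ∈ K`, and a `u` with `u^{k+2n} = −1`
(`T5BergmanKTypes.exists_pow_eq_neg_one`) forces **`I = 0`** — for every `k ≥ 2`, every `λ` and all
`m, n`, with no integrability hypothesis (`integral_matrixCoeff_mul_sph`; the honest instance is
`k ≥ 3`, `λ < k`, `k + λ > 2`, where `c_{mn} φ_λ ∈ L¹(ν)` by `T5SU11KFiniteMajorant`). The spherical
transform of a `K`-finite coefficient of the holomorphic discrete series VANISHES (the discrete series
has no `K`-fixed vector), while the transform of its MODULUS is the positive Gamma quotient of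
`T5SU11JacobiTransform`; the real and imaginary parts, and the integrals against `Ξ`, vanish as well
(`integral_re_matrixCoeff_mul_sph`, `integral_im_matrixCoeff_mul_sph`, `integral_matrixCoeff_mul_sph_one`).
Nothing is claimed about (N).

Blind lane: Mathlib + the HodgeRepro2 prefix only; no sorry; axioms ⊆ {propext, Classical.choice,
Quot.sound}.
-/

namespace Summit.Ventures.HodgeRepro2.T5SU11CoeffSphericalOrthogonal

open MeasureTheory MeasureTheory.Measure Metric Set Filter Topology Complex
open T5SU11Unimodular T5SU11Fibration T5SU11Cartan T5SU11OneParameter T5HaarCircle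
  T5BergmanCoefficient T5SU11FibrationHaar T5BergmanMatrixCoeff T5BergmanCoeffCartan
  T5BergmanKTypes T5SU11SphericalFunction T5SU11KFiniteMajorant
open scoped Real

section measure

variable [MeasurableSpace Circle] [BorelSpace Circle]

/-- **The spherical transform of a `K`-finite coefficient vanishes**:
`∫_G ⟨π_k(g) zᵐ, zⁿ⟩_k φ_λ(g) dν = 0` for every `k ≥ 2`, `λ`, `m`, `n` (no integrability needed: the
identity `I = u^{-(k+2n)} I` holds for the Bochner integral unconditionally). -/
theorem integral_matrixCoeff_mul_sph (k : ℕ) (hk : 2 ≤ k) (lam : ℝ) (m n : ℕ) :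
    ∫ g, matrixCoeff k (fun z => z ^ m) (fun z => z ^ n) g * (sph lam g : ℂ) ∂(nu haarCircle) = 0 := by
  set I := ∫ g, matrixCoeff k (fun z => z ^ m) (fun z => z ^ n) g * (sph lam g : ℂ) ∂(nu haarCircle)
    with hI
  have hchar : ∀ u : Circle, I = ((u : ℂ)⁻¹) ^ (k + 2 * n) * I := by
    intro u
    calc I = ∫ g, (fun g => matrixCoeff k (fun z => z ^ m) (fun z => z ^ n) g * (sph lam g : ℂ))
          (rot u * g) ∂(nu haarCircle) := (integral_mul_left_eq_self _ (rot u)).symm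
      _ = ∫ g, ((u : ℂ)⁻¹) ^ (k + 2 * n)
          * (matrixCoeff k (fun z => z ^ m) (fun z => z ^ n) g * (sph lam g : ℂ)) ∂(nu haarCircle) := by
        refine integral_congr_ae (Filter.Eventually.of_forall fun g => ?_)
        beta_reduce
        rw [matrixCoeff_rot_mul_monomial k n hk, sph_rot_mul]
        ring
      _ = ((u : ℂ)⁻¹) ^ (k + 2 * n) * I := integral_const_mul _ _
  obtain ⟨u, hu⟩ := exists_pow_eq_neg_one (d := k + 2 * n) (by omega)
  have h := hchar u
  rw [inv_pow, hu] at h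
  -- `I = (-1)⁻¹ * I = -I`, hence `I = 0`
  linear_combination (1 / 2 : ℂ) * h

/-- The real part: `∫_G Re ⟨π_k(g) zᵐ, zⁿ⟩_k · φ_λ(g) dν = 0` (`k ≥ 3`, `λ < k`, `k + λ > 2`, where the
integrand is integrable). -/
theorem integral_re_matrixCoeff_mul_sph {k : ℕ} (hk : 3 ≤ k) {lam : ℝ} (h1 : lam < k)
    (h2 : 2 < k + lam) (m n : ℕ) :
    ∫ g, (matrixCoeff k (fun z => z ^ m) (fun z => z ^ n) g).re * sph lam g ∂(nu haarCircle) = 0 := by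
  have hint := integrable_matrixCoeff_mul_sph hk h1 h2 m n
  have h := integral_matrixCoeff_mul_sph k (by omega) lam m n
  have hre := integral_re hint
  simp only [RCLike.re_to_complex] at hre
  rw [h, Complex.zero_re] at hre
  rw [← hre]
  refine integral_congr_ae (Filter.Eventually.of_forall fun g => ?_)
  simp only [Complex.mul_re, Complex.ofReal_re, Complex.ofReal_im, mul_zero, sub_zero]

/-- The imaginary part: `∫_G Im ⟨π_k(g) zᵐ, zⁿ⟩_k · φ_λ(g) dν = 0`. -/
theorem integral_im_matrixCoeff_mul_sph {k : ℕ} (hk : 3 ≤ k) {lam : ℝ} (h1 : lam < k)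
    (h2 : 2 < k + lam) (m n : ℕ) :
    ∫ g, (matrixCoeff k (fun z => z ^ m) (fun z => z ^ n) g).im * sph lam g ∂(nu haarCircle) = 0 := by
  have hint := integrable_matrixCoeff_mul_sph hk h1 h2 m n
  have h := integral_matrixCoeff_mul_sph k (by omega) lam m n
  have him := integral_im hint
  simp only [RCLike.im_to_complex] at him
  rw [h, Complex.zero_im] at him
  rw [← him]
  refine integral_congr_ae (Filter.Eventually.of_forall fun g => ?_)
  simp only [Complex.mul_im, Complex.ofReal_re, Complex.ofReal_im, mul_zero, zero_add]

/-- **Against `Ξ`**: `∫_G ⟨π_k(g) zᵐ, zⁿ⟩_k Ξ(g) dν = 0` for every `k ≥ 2` — while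
`∫_G |⟨π_k(g) zᵐ, zⁿ⟩_k| Ξ(g) dν` is finite and bounded by `T5SU11KFiniteMajorant`. -/
theorem integral_matrixCoeff_mul_sph_one (k : ℕ) (hk : 2 ≤ k) (m n : ℕ) :
    ∫ g, matrixCoeff k (fun z => z ^ m) (fun z => z ^ n) g * (sph 1 g : ℂ) ∂(nu haarCircle) = 0 :=
  integral_matrixCoeff_mul_sph k hk 1 m n

/-- **The lowest-weight coefficient itself**: `∫_G a(g)^{-k} φ_λ(g) dν = 0` for `k ≥ 2` (the
`(m, n) = (0, 0)` case: `⟨π_k(g) 1, 1⟩_k = ⟨1,1⟩_k a(g)^{-k}`, so its spherical transform vanishes although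
the transform of its modulus `(1 − |g·0|²)^{k/2}` is the Gamma quotient of `T5SU11JacobiTransform`). -/
theorem integral_matrixCoeff_one_one_mul_sph (k : ℕ) (hk : 2 ≤ k) (lam : ℝ) :
    ∫ g, matrixCoeff k (fun z => z ^ 0) (fun z => z ^ 0) g * (sph lam g : ℂ) ∂(nu haarCircle) = 0 :=
  integral_matrixCoeff_mul_sph k hk lam 0 0

end measure

end Summit.Ventures.HodgeRepro2.T5SU11CoeffSphericalOrthogonal
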